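import Mathlib
import Summits.ValiantsHypothesis.ValiantsHypothesis.Theorems.FifoMatchingNNLowDegreeCofactorHardSupportGenericExpBound
import HarnessLib

/-!
# Route FifoMatching — crux `NNDivisionHard` (stmt-ValiantsHypothesis-21181): the union bound in SUPPORT-BETWEEN form —
# lower bounds for sub-faces of `NN_n` from a spread measure they cover

`SupportGenericExpBound.exp_lower_bound_of_support_eq` bounds `L₊(g)` for `g` with EXACTLY the support of `NN_n`.  The
rungs of `…NNDivisionHardLocalCofactor` reduce local cofactors to FACES `NN_n^{¬I}` of `NN_n` (support a SUBSET), so the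
union bound is re-run here with the support of `g` merely BETWEEN the support of the spread measure and that of `NN_n`:

* `isHomogeneous_of_support_subset`;
* ★ `exists_balanced_split_of_complexity_of_support_between`, ★ `one_le_complexity_mul_of_spread_of_support_between` — **if
  `supp g ⊆ supp NN_n` and a probability weighting `μ` of the nest-free perfect matchings with `μ M ≠ 0 ⇒ x^M ∈ supp g`
  respects every balanced split with mass `≤ β`, then `1 ≤ 4 · L₊(g) · (n+1)² · β`.**

WHAT IS MISSING (recorded, not done): the thick-queue measure of `NNMonotoneHardMeasure.exists_thick_measure` is supported on
FIFO pairings of padded words `U^L v D^L` with thick middle, all of whose arcs have length `> L − m`; exporting that support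
property turns `LocalCofactor.complexity_longFace_le_of_shortLocal` into «cofactors on arcs of length `≤ L − m` (order
`n^{2/3}`) are not certificates».  HONEST FRAMING: a re-run of a proved engine with weaker hypotheses; stmt-21181 stays OPEN;
nothing here bears on `NNNotVP` or on VP ≠ VNP (NOT proved).
References: Hrubeš–Yehudayoff 2021 §6 Problem 2 [HrubesYehudayoff2021]; Jerrum–Snir 1982 [JerrumSnir1982].
-/

noncomputable section

-- Sub = Summit single-conjunct layout: the duplicated namespace component is mandated by the tree.
set_option linter.dupNamespace false
set_option autoImplicit false

namespace Summit.ValiantsHypothesis.ValiantsHypothesis.Theorems.FifoMatching.NNDivisionHard.SupportBetween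

open MvPolynomial Finset Literature.Computability.AlgebraicComplexity
open Summit.ValiantsHypothesis.ValiantsHypothesis.Theorems.FifoMatching.NNMonotoneHard
open Summit.ValiantsHypothesis.ValiantsHypothesis.Theorems.FifoMatching.NNMonotoneExpBound
open Summit.ValiantsHypothesis.ValiantsHypothesis.Theorems.FifoMatching.NNLowDegreeCofactorHard
  (exists_balanced_vertex_split_of_support_subset)
open scoped NNReal

/-- A polynomial whose support lies inside that of `NN_n` is homogeneous of degree `n`. [folklore] -/
theorem isHomogeneous_of_support_subset {n : ℕ} {g : MvPolynomial (Fin (2 * n) × Fin (2 * n)) ℝ≥0}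
    (hg : g.support ⊆ (nestFreeMatchingPoly n ℝ≥0).support) : g.IsHomogeneous n := by
  intro d hd
  have hd' : d ∈ (nestFreeMatchingPoly n ℝ≥0).support := hg (mem_support_iff.2 hd)
  exact nestFreeMatchingPoly_isHomogeneous n (mem_support_iff.1 hd')

/-- **Union bound, support-BETWEEN form.** For `n ≥ 3`, every `g ∈ ℝ≥0[x]` whose support lies INSIDE that of `NN_n`, and
every nonnegative weighting `μ` of the nest-free perfect matchings of `[2n]` of total mass `1` whose support is COVERED by
the support of `g` (`μ M ≠ 0 ⇒ x^M ∈ supp g`), some balanced split `S ⊆ [2n]` (`2n < 3|S| ≤ 4n`) is respected with mass at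
least `1 / (4 · L₊(g) · (n+1)²)`: the proof of `SupportGenericExpBound.exists_balanced_split_of_complexity_of_support_eq`
verbatim, the covering now read off `μ`. [folklore] -/
theorem exists_balanced_split_of_complexity_of_support_between {n : ℕ} (hn : 3 ≤ n)
    {g : MvPolynomial (Fin (2 * n) × Fin (2 * n)) ℝ≥0}
    (hg : g.support ⊆ (nestFreeMatchingPoly n ℝ≥0).support)
    (μ : (Fin (2 * n) → Fin (2 * n)) → ℝ≥0) (hμ : ∑ M ∈ nestFreeMatchings (2 * n), μ M = 1)
    (hcov : ∀ M ∈ nestFreeMatchings (2 * n), μ M ≠ 0 → arcExponent M ∈ g.support) :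
    ∃ S : Finset (Fin (2 * n)), 2 * n < 3 * S.card ∧ 3 * S.card ≤ 4 * n ∧
      (1 : ℝ≥0) ≤ (4 * complexity g * (n + 1) ^ 2 : ℕ) *
        ∑ M ∈ (nestFreeMatchings (2 * n)).filter (fun M => ∀ i, i ∈ S ↔ M i ∈ S), μ M := by
  classical
  set s := complexity g with hs
  obtain ⟨L, hLlen, hLsum, hL⟩ := exists_homogeneous_balanced_decomposition_of_complexity_le
    (le_refl s) (isHomogeneous_of_support_subset hg) hn
  -- the splits attached to the terms
  have hsplit : ∀ t ∈ L, ∃ S : Finset (Fin (2 * n)), 2 * n < 3 * S.card ∧ 3 * S.card ≤ 4 * n ∧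
      ∀ x ∈ (t.2.1 * t.2.2).support, ∃ M ∈ nestFreeMatchings (2 * n),
        arcExponent M = x ∧ ∀ i, i ∈ S ↔ M i ∈ S := by
    intro t ht
    obtain ⟨hhom, h1, h2, hne, hle⟩ := hL t ht
    have hsub : (t.2.1 * t.2.2).support ⊆
        (∑ M ∈ nestFreeMatchings (2 * n), arcMonomial ℝ≥0 M).support := by
      intro x hx
      rw [← nestFreeMatchingPoly_eq_sum_arcMonomial]
      refine hg (mem_support_iff.2 fun h0 => ?_)
      exact (mem_support_iff.1 hx) (le_antisymm ((hle x).trans h0.le) zero_le)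
    obtain ⟨S, hScard, hS⟩ := exists_balanced_vertex_split_of_support_subset
      nestFreeMatchings_subset_perfectMatchings hhom hne hsub
    exact ⟨S, by omega, by omega, hS⟩
  choose! Sp hSp using hsplit
  -- every nest-free matching lies in the class of some term
  have hcover : ∀ M ∈ nestFreeMatchings (2 * n), μ M ≠ 0 → ∃ t ∈ L, ∀ i, i ∈ Sp t ↔ M i ∈ Sp t := by
    intro M hM hμM
    have hx : arcExponent M ∈ g.support := hcov M hM hμM
    have hx' : ∃ t ∈ L, arcExponent M ∈ (t.2.1 * t.2.2).support := by
      by_contra hcon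
      push Not at hcon
      rw [mem_support_iff, ← hLsum] at hx
      apply hx
      rw [← coeffAddMonoidHom_apply, map_list_sum]
      apply List.sum_eq_zero
      intro c hc
      rw [List.map_map, List.mem_map] at hc
      obtain ⟨t, ht, rfl⟩ := hc
      simpa [coeffAddMonoidHom_apply, notMem_support_iff] using hcon t ht
    obtain ⟨t, ht, hxt⟩ := hx'
    obtain ⟨M', hM', hM'x, hresp⟩ := (hSp t ht).2.2 _ hxt
    have hMM' : M' = M := arcExponent_injOn (nestFreeMatchings_subset_perfectMatchings hM')
      (nestFreeMatchings_subset_perfectMatchings hM) hM'x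
    subst hMM'
    exact ⟨t, ht, hresp⟩
  -- the union bound
  set T := L.toFinset with hT
  set mass : (ℕ × MvPolynomial (Fin (2 * n) × Fin (2 * n)) ℝ≥0 ×
      MvPolynomial (Fin (2 * n) × Fin (2 * n)) ℝ≥0) → ℝ≥0 := fun t =>
    ∑ M ∈ (nestFreeMatchings (2 * n)).filter (fun M => ∀ i, i ∈ Sp t ↔ M i ∈ Sp t), μ M
    with hmass
  have hbound : (1 : ℝ≥0) ≤ ∑ t ∈ T, mass t := by
    rw [← hμ]
    have hrw : ∀ t ∈ T, mass t = ∑ M ∈ nestFreeMatchings (2 * n),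
        if (∀ i, i ∈ Sp t ↔ M i ∈ Sp t) then μ M else 0 := by
      intro t _
      simp only [hmass]
      rw [sum_filter]
    rw [sum_congr rfl hrw, sum_comm]
    refine sum_le_sum fun M hM => ?_
    by_cases hμM : μ M = 0
    · rw [hμM]; exact zero_le
    obtain ⟨t, ht, hresp⟩ := hcover M hM hμM
    have ht' : t ∈ T := by rw [hT, List.mem_toFinset]; exact ht
    refine le_trans ?_ (single_le_sum (f := fun t => if (∀ i, i ∈ Sp t ↔ M i ∈ Sp t)
      then μ M else 0) (fun _ _ => zero_le) ht')
    simp only [if_pos hresp, le_refl]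
  have hTne : T.Nonempty := by
    rw [nonempty_iff_ne_empty]
    rintro hTe
    rw [hTe, sum_empty] at hbound
    exact absurd hbound (by simp)
  obtain ⟨t₀, ht₀, hmax⟩ := exists_max_image T mass hTne
  have ht₀L : t₀ ∈ L := by rw [hT, List.mem_toFinset] at ht₀; exact ht₀
  refine ⟨Sp t₀, (hSp t₀ ht₀L).1, (hSp t₀ ht₀L).2.1, ?_⟩
  calc (1 : ℝ≥0) ≤ ∑ t ∈ T, mass t := hbound
    _ ≤ ∑ _t ∈ T, mass t₀ := sum_le_sum hmax
    _ = (T.card : ℝ≥0) * mass t₀ := by rw [sum_const, nsmul_eq_mul]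
    _ ≤ ((4 * s * (n + 1) ^ 2 : ℕ) : ℝ≥0) * mass t₀ := by
        gcongr
        exact_mod_cast (List.toFinset_card_le (l := L)).trans hLlen

/-- **Lower bound from a spread measure, support-BETWEEN form.** If a probability weighting of the nest-free perfect
matchings of `[2n]` (`n ≥ 3`), covered by the support of `g ⊆ supp NN_n`, respects every balanced split with mass `≤ β`,
then `1 ≤ 4 · L₊(g) · (n+1)² · β`. [folklore] -/
theorem one_le_complexity_mul_of_spread_of_support_between {n : ℕ} (hn : 3 ≤ n)
    {g : MvPolynomial (Fin (2 * n) × Fin (2 * n)) ℝ≥0}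
    (hg : g.support ⊆ (nestFreeMatchingPoly n ℝ≥0).support) {β : ℝ≥0}
    (μ : (Fin (2 * n) → Fin (2 * n)) → ℝ≥0) (hμ : ∑ M ∈ nestFreeMatchings (2 * n), μ M = 1)
    (hcov : ∀ M ∈ nestFreeMatchings (2 * n), μ M ≠ 0 → arcExponent M ∈ g.support)
    (hβ : ∀ S : Finset (Fin (2 * n)), 2 * n < 3 * S.card → 3 * S.card ≤ 4 * n →
      (∑ M ∈ (nestFreeMatchings (2 * n)).filter (fun M => ∀ i, i ∈ S ↔ M i ∈ S), μ M) ≤ β) :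
    (1 : ℝ) ≤ 4 * (complexity g : ℝ) * ((n : ℝ) + 1) ^ 2 * (β : ℝ) := by
  obtain ⟨S, h1, h2, hbig⟩ := exists_balanced_split_of_complexity_of_support_between hn hg μ hμ hcov
  have h := hbig.trans (mul_le_mul_of_nonneg_left (hβ S h1 h2) zero_le)
  have h' := NNReal.coe_le_coe.2 h
  push_cast at h'
  linarith [h']

end Summit.ValiantsHypothesis.ValiantsHypothesis.Theorems.FifoMatching.NNDivisionHard.SupportBetween

end
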